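import Summits.CriticalPhenomena.CardyFormulaZ2.Theorems.CardyAnchoredRigiditySubseqCardySelfDualMesh
import Summits.CriticalPhenomena.CardyFormulaZ2.Theorems.CardyAnchoredRigiditySubseqCardyRectDuality
import Summits.CriticalPhenomena.CardyFormulaZ2.Theorems.CardyAnchoredRigiditySubseqCardyJointLimitRotation
import Summits.CriticalPhenomena.CardyFormulaZ2.Theorems.CardyWhiteToColouredSimilarityUpgradeStubLimitDuality

/-!
# Self-duality of EVERY joint sequential limit on EVERY conformal rectangle
# (crux `SubseqCardy`, stmt-CriticalPhenomena-5768, line `registered`: structure of joint limits, part 8c)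

Route `CardyAnchoredRigidity` (decl shared with `CardyLocalRigidity`), sub-problem `CardyFormulaZ2`, lead c4.
A JOINT SEQUENTIAL LIMIT is a pair (`u → 0⁺`, `g : ConformalRectangle → ℝ`) with
`bondDomainCrossingProb R (u n) → g R` for every conformal rectangle `R` — the hypothesis of the two open
stubs S2 (⟺ item 8266) and S3 (⟺ item 8271). Part 7 (`…SubseqCardyRectDuality.lean`) proved
self-duality of `g` on axis-parallel boxes from the exact lattice duality of rectangle crossings. This
file proves it in general:

* `JointLimit.add_shift_eq_one` / registered sub-goal `jointLimit_selfDual` — **for every joint sequential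
  limit `g`, every conformal rectangle `R = (Ω; a, b, c, d)` and its cyclic re-marking `R⁺ = (Ω; b, c, d, a)`
  (same carrier, arcs shifted by one; `MarkedDomain.exists_shiftMarks`), `g R + g R⁺ = 1`.**

So every subsequential scaling limit of the critical bond-`ℤ²` crossing probabilities is self-dual; for a
conformally invariant `g = G ∘ crossRatio` (S2) this is the functional equation `G η + G (1 - η) = 1`
of Cardy's function, and together with parts 2–6 (translation / `D₄` / (DKKMO-)rotation invariance,
dilation intertwining, squares `= 1/2`) it is the complete list of EXACT constraints on joint limits that
the lattice is known to impose unconditionally.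

Proof. Fix a square model `Φ` of `R` (`exists_isSquareModel`). Part 8b (`selfDual_mesh_bounds`) gives,
for every margin `ν ∈ (0, 1/2)` and all small meshes, `1 ≤ P[𝒞_δ(R)] + P[𝒞_δ(L_ν)]` and
`P[𝒞_δ(R)] + P[𝒞_δ(U_ν)] ≤ 1` for the Schramm–Smirnov quad-crossing probabilities of `R` and of the two
transversal comparison quads `L_ν`, `U_ν` (images under `Φ` of the boxes
`[-1+2ν, 1-2ν] × [-1-2ν, 1+2ν]`, resp. `[-1-2ν, 1+2ν] × [-1+2ν, 1-2ν]`, crossed between the images of the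
vertical sides). Along `u n` these probabilities converge to `g` (dictionary of part 3,
`JointLimit.eventually_abs_bond_sub_quadCrossingProb_le`), so `1 ≤ g R + g L_ν` and `g R + g U_ν ≤ 1`.
Finally `L_ν`, `U_ν` have the carrier and (exchanged) arcs of `R⁺.map T` for the conjugated stretch
`T = Φ ∘ A ∘ Φ⁻¹`, `A (x + iy) = (1 ∓ 2ν) x + i (1 ± 2ν) y` (`bondDomainCrossingProb_perturbQuad_eq_map`,
crossing events being symmetric in the two arcs), and `T → id` uniformly near `closure Ω` as `ν → 0`
(`deform_close'`), so `g L_ν, g U_ν → g R⁺` by Schramm–Smirnov continuity of `g` (part 2,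
`JointLimit.abs_sub_map_le`).

References: O. Schramm, S. Smirnov, Ann. Probab. 39 (2011) §1.3, §5, proof of Lemma 6.1; G. Grimmett,
*Percolation* (1999) §11.2; J. Cardy, J. Phys. A 25 (1992) L201 (`F(η) + F(1-η) = 1`).
-/

noncomputable section

namespace Summit.CriticalPhenomena.CardyFormulaZ2.Cruxes.SubseqCardy.Birth

open Set Filter Topology Metric MeasureTheory
open Literature.Probability.RandomPlanarGeometry (ConformalRectangle MarkedDomain)
open Literature.Probability.LatticeModels
open Literature.Probability.Percolation (BondConfig bondPercolation half bondDomainCrossingProb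
  quadCrossingProb perturbQuad rectQuad rectQuad_carrier mem_rectQuad_arc_zero
  mem_rectQuad_arc_two IsSquareModel exists_isSquareModel unitSquareQuad unitSquareQuad_carrier)
open Literature.Probability.Percolation.SSContinuity (swapC)

namespace SelfDual

/-! ### Images of model intervals under positive dilations -/

/-- `x ↦ c x` maps `(-1, 1)` onto `(-c, c)` (`c > 0`). [folklore] -/
theorem image_mul_Ioo {c : ℝ} (hc : 0 < c) : (fun x : ℝ => c * x) '' Ioo (-1) 1 = Ioo (-c) c := by
  ext y
  simp only [mem_image, mem_Ioo]
  constructor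
  · rintro ⟨x, ⟨h1, h2⟩, rfl⟩; constructor <;> nlinarith
  · rintro ⟨h1, h2⟩
    refine ⟨y / c, ⟨?_, ?_⟩, mul_div_cancel₀ y hc.ne'⟩
    · rw [lt_div_iff₀ hc]; linarith
    · rw [div_lt_iff₀ hc]; linarith

/-- `x ↦ c x` maps `[-1, 1]` onto `[-c, c]` (`c > 0`). [folklore] -/
theorem image_mul_Icc {c : ℝ} (hc : 0 < c) : (fun x : ℝ => c * x) '' Icc (-1) 1 = Icc (-c) c := by
  ext y
  simp only [mem_image, mem_Icc]
  constructor
  · rintro ⟨x, ⟨h1, h2⟩, rfl⟩; constructor <;> nlinarith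
  · rintro ⟨h1, h2⟩
    refine ⟨y / c, ⟨?_, ?_⟩, mul_div_cancel₀ y hc.ne'⟩
    · rw [le_div_iff₀ hc]; linarith
    · rw [div_le_iff₀ hc]; linarith

/-! ### The comparison quads have the carrier and the exchanged arcs of a deformation of `R⁺` -/

variable {R R' : ConformalRectangle} {Φ : ℂ ≃ₜ ℂ}

/-- **The transversal comparison quad is a deformation of the re-marked rectangle, crossed the other
way round.** Let `Φ` be a square model of `R`, `R⁺` the re-marking (`R⁺.carrier = R.carrier`,
`R⁺.arc 0 = R.arc 1`, `R⁺.arc 2 = R.arc 3`), `A (x + iy) = y₁ x + i x₁ y` a stretch (`x₁, y₁ > 0`) and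
`T = Φ ∘ A ∘ Φ⁻¹`. Then the quad `(swap ∘ Φ)([-x₁, x₁] × [-y₁, y₁])` (crossed between the `Φ`-images of
the vertical sides `re = ∓y₁`) and `R⁺.map T` have the same carrier and exchanged arcs `0 ↔ 2`, hence
the same bond-`ℤ²` crossing probabilities at every mesh. [folklore] -/
theorem bondDomainCrossingProb_perturbQuad_eq_map (hΦ : IsSquareModel R Φ) (hc : R'.carrier = R.carrier)
    (h0 : R'.arc 0 = R.arc 1) (h2 : R'.arc 2 = R.arc 3) {x₀ x₁ y₀ y₁ : ℝ} (hx₁ : 0 < x₁) (hy₁ : 0 < y₁)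
    (hx₀ : x₀ = -x₁) (hy₀ : y₀ = -y₁) (hx : x₀ < x₁) (hy : y₀ < y₁)
    (A : ℂ ≃ₜ ℂ) (hA : ∀ z, (A z).re = y₁ * z.re ∧ (A z).im = x₁ * z.im) (δ : ℝ) :
    bondDomainCrossingProb (perturbQuad (swapC.trans Φ) x₀ x₁ y₀ y₁ hx hy) δ =
      bondDomainCrossingProb (R'.map (Φ.symm.trans (A.trans Φ))) δ := by
  subst hx₀ hy₀
  have hsw : ∀ z : ℂ, (swapC z).re = id z.im ∧ (swapC z).im = id z.re := fun z => ⟨rfl, rfl⟩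
  have hΨ : ((swapC.trans Φ : ℂ ≃ₜ ℂ) : ℂ → ℂ) = Φ ∘ swapC := rfl
  have hT : ((Φ.symm.trans (A.trans Φ) : ℂ ≃ₜ ℂ) : ℂ → ℂ) = Φ ∘ A ∘ Φ.symm := rfl
  -- carriers
  have hcarP : (perturbQuad (swapC.trans Φ) (-x₁) x₁ (-y₁) y₁ hx hy).carrier =
      Φ '' (Ioo (-y₁) y₁ ×ℂ Ioo (-x₁) x₁) := by
    rw [perturbQuad, MarkedDomain.carrier_map, rectQuad_carrier, hΨ, image_comp,
      JointLimit.image_reProdIm_of_im_re hsw, image_id, image_id]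
  have hcarM : (R'.map (Φ.symm.trans (A.trans Φ))).carrier = Φ '' (Ioo (-y₁) y₁ ×ℂ Ioo (-x₁) x₁) := by
    rw [MarkedDomain.carrier_map, hc, hT, image_comp, image_comp, CountableApprox.symm_image_carrier hΦ,
      unitSquareQuad_carrier, JointLimit.image_reProdIm_of_re_im hA, image_mul_Ioo hy₁, image_mul_Ioo hx₁]
  -- arcs of the comparison quad
  have harc0P : (perturbQuad (swapC.trans Φ) (-x₁) x₁ (-y₁) y₁ hx hy).arc 0 = Φ '' ({-y₁} ×ℂ Icc (-x₁) x₁) := by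
    rw [perturbQuad, MarkedDomain.arc_map, show (rectQuad (-x₁) x₁ (-y₁) y₁ hx hy).arc 0 =
      {z : ℂ | z.im = -y₁ ∧ z.re ∈ Icc (-x₁) x₁} from Set.ext fun z => mem_rectQuad_arc_zero hx hy,
      JointLimit.setOf_im_eq_re_mem, hΨ, image_comp, JointLimit.image_reProdIm_of_im_re hsw, image_id, image_id]
  have harc2P : (perturbQuad (swapC.trans Φ) (-x₁) x₁ (-y₁) y₁ hx hy).arc 2 = Φ '' ({y₁} ×ℂ Icc (-x₁) x₁) := by
    rw [perturbQuad, MarkedDomain.arc_map, show (rectQuad (-x₁) x₁ (-y₁) y₁ hx hy).arc 2 =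
      {z : ℂ | z.im = y₁ ∧ z.re ∈ Icc (-x₁) x₁} from Set.ext fun z => mem_rectQuad_arc_two hx hy,
      JointLimit.setOf_im_eq_re_mem, hΨ, image_comp, JointLimit.image_reProdIm_of_im_re hsw, image_id, image_id]
  -- arcs of the deformed re-marked rectangle
  have harc0M : (R'.map (Φ.symm.trans (A.trans Φ))).arc 0 = Φ '' ({y₁} ×ℂ Icc (-x₁) x₁) := by
    rw [MarkedDomain.arc_map, h0, hT, image_comp, image_comp, CountableApprox.symm_image_arc hΦ 1,
      show unitSquareQuad.arc 1 = {z : ℂ | z.re = 1 ∧ z.im ∈ Icc (-1) 1} from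
        Set.ext fun z => Literature.Probability.Percolation.SquareModel.mem_arc_one,
      JointLimit.setOf_re_eq_im_mem, JointLimit.image_reProdIm_of_re_im hA, image_singleton, image_mul_Icc hx₁,
      mul_one]
  have harc2M : (R'.map (Φ.symm.trans (A.trans Φ))).arc 2 = Φ '' ({-y₁} ×ℂ Icc (-x₁) x₁) := by
    rw [MarkedDomain.arc_map, h2, hT, image_comp, image_comp, CountableApprox.symm_image_arc hΦ 3,
      show unitSquareQuad.arc 3 = {z : ℂ | z.re = -1 ∧ z.im ∈ Icc (-1) 1} from
        Set.ext fun z => Literature.Probability.Percolation.SquareModel.mem_arc_three,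
      JointLimit.setOf_re_eq_im_mem, JointLimit.image_reProdIm_of_re_im hA, image_singleton, image_mul_Icc hx₁,
      mul_neg, mul_one]
  simp only [bondDomainCrossingProb]
  rw [hcarP, hcarM, harc0P, harc2P, harc0M, harc2M]
  exact Summit.CriticalPhenomena.CardyFormulaZ2.Cruxes.SimilarityUpgrade.Stubs.discreteCrossingProb_arc_swap half _ δ _ _

/-! ### Conjugated stretches tend to the identity -/

/-- **Conjugated near-identity stretches move compacta little**: on a compact `K`, the conjugate
`Φ ∘ A ∘ Φ⁻¹` of an axis stretch `A (x + iy) = a x + i b y` moves points by at most `η` once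
`|a - 1|, |b - 1| ≤ τ₁(Φ, K, η)` (uniform continuity of `Φ` on a large disc containing `Φ⁻¹(K)`).
[folklore] -/
theorem deform_close' (Φ : ℂ ≃ₜ ℂ) {K : Set ℂ} (hK : IsCompact K) {η : ℝ} (hη : 0 < η) :
    ∃ τ₁ : ℝ, 0 < τ₁ ∧ ∀ a b : ℝ, |a - 1| ≤ τ₁ → |b - 1| ≤ τ₁ → ∀ A : ℂ ≃ₜ ℂ,
      (∀ z : ℂ, (A z).re = a * z.re ∧ (A z).im = b * z.im) →
      ∀ z ∈ K, dist ((Φ.symm.trans (A.trans Φ)) z) z ≤ η := by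
  obtain ⟨M₀, hM₀⟩ := (hK.image Φ.symm.continuous).isBounded.exists_norm_le
  set M : ℝ := max M₀ 0 with hMdef
  have hM : 0 ≤ M := le_max_right _ _
  obtain ⟨θ, hθ, huc⟩ := Metric.uniformContinuousOn_iff.1
    ((isCompact_closedBall (0 : ℂ) (M + 1)).uniformContinuousOn_of_continuous Φ.continuous.continuousOn) η hη
  refine ⟨min θ 1 / (4 * (M + 1)), by positivity, fun a b ha hb A hA z hz => ?_⟩
  set w := Φ.symm z with hw
  have hwM : ‖w‖ ≤ M := (hM₀ w (mem_image_of_mem _ hz)).trans (le_max_left _ _)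
  have hτ : min θ 1 / (4 * (M + 1)) * M ≤ min θ 1 / 4 := by
    rw [div_mul_eq_mul_div, div_le_div_iff₀ (by positivity) (by positivity)]
    nlinarith [le_min hθ.le zero_le_one, min_le_right θ 1, lt_min hθ one_pos]
  -- `‖A w - w‖ ≤ |a-1| |re w| + |b-1| |im w| ≤ 2 τ₁ M ≤ min θ 1 / 2`
  have hAw : dist (A w) w < min θ 1 := by
    rw [dist_eq_norm]
    have hre : (A w - w).re = (a - 1) * w.re := by rw [Complex.sub_re, (hA w).1]; ring
    have him : (A w - w).im = (b - 1) * w.im := by rw [Complex.sub_im, (hA w).2]; ring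
    have h1 : |(A w - w).re| ≤ min θ 1 / (4 * (M + 1)) * M := by
      rw [hre, abs_mul]
      exact mul_le_mul ha ((Complex.abs_re_le_norm w).trans hwM) (abs_nonneg _) (by positivity)
    have h2 : |(A w - w).im| ≤ min θ 1 / (4 * (M + 1)) * M := by
      rw [him, abs_mul]
      exact mul_le_mul hb ((Complex.abs_im_le_norm w).trans hwM) (abs_nonneg _) (by positivity)
    calc ‖A w - w‖ ≤ |(A w - w).re| + |(A w - w).im| := Complex.norm_le_abs_re_add_abs_im _
      _ ≤ min θ 1 / 4 + min θ 1 / 4 := add_le_add (h1.trans hτ) (h2.trans hτ)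
      _ < min θ 1 := by linarith [lt_min hθ one_pos]
  have hwB : w ∈ closedBall (0 : ℂ) (M + 1) := by
    rw [mem_closedBall, dist_zero_right]; linarith
  have hAwB : A w ∈ closedBall (0 : ℂ) (M + 1) := by
    rw [mem_closedBall, dist_zero_right]
    have : ‖A w‖ ≤ ‖w‖ + dist (A w) w := by rw [dist_eq_norm]; exact norm_le_insert' (A w) w
    linarith [hAw.le.trans (min_le_right θ 1)]
  have key := huc (A w) hAwB w hwB (hAw.trans_le (min_le_left _ _))
  have hΦw : Φ w = z := by rw [hw, Homeomorph.apply_symm_apply]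
  rw [hΦw] at key
  show dist (Φ (A (Φ.symm z))) z ≤ η
  rw [← hw]
  exact key.le

end SelfDual

namespace JointLimit

variable {u : ℕ → ℝ} {g : ConformalRectangle → ℝ}

/-- **Quad-crossing probabilities converge to the joint limit too**: along the mesh sequence,
`quadCrossingProb (u n) Q → g Q` for every conformal rectangle `Q` (dictionary of part 3).
[cite: SchrammSmirnov2011, §5 Lemma 5.1 and eq. (5.1)] -/
theorem tendsto_quadCrossingProb (hu : Tendsto u atTop (𝓝[>] (0 : ℝ)))
    (hg : ∀ R : ConformalRectangle, Tendsto (fun n => bondDomainCrossingProb R (u n)) atTop (𝓝 (g R)))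
    (Q : ConformalRectangle) : Tendsto (fun n => quadCrossingProb (u n) Q) atTop (𝓝 (g Q)) := by
  have h0 : Tendsto (fun n => quadCrossingProb (u n) Q - bondDomainCrossingProb Q (u n)) atTop (𝓝 0) := by
    rw [Metric.tendsto_nhds]
    intro ε hε
    filter_upwards [hu.eventually (eventually_abs_bond_sub_quadCrossingProb_le Q (half_pos hε))] with n hn
    rw [Real.dist_eq, sub_zero, abs_sub_comm]
    linarith
  have := h0.add (hg Q)
  simpa using this

/-- **Self-duality of joint sequential limits on every conformal rectangle**: `g R + g R⁺ = 1` for the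
cyclic re-marking `R⁺` of `R` (same carrier, arcs shifted by one). [cite: SchrammSmirnov2011, §1.3] -/
theorem add_shift_eq_one (hu : Tendsto u atTop (𝓝[>] (0 : ℝ)))
    (hg : ∀ R : ConformalRectangle, Tendsto (fun n => bondDomainCrossingProb R (u n)) atTop (𝓝 (g R)))
    (R R' : ConformalRectangle) (hc : R'.carrier = R.carrier) (h0 : R'.arc 0 = R.arc 1)
    (h2 : R'.arc 2 = R.arc 3) : g R + g R' = 1 := by
  obtain ⟨Φ, hΦ⟩ := exists_isSquareModel R
  have hq := tendsto_quadCrossingProb hu hg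
  have hupos : ∀ᶠ n in atTop, 0 < u n := (tendsto_nhdsWithin_iff.1 hu).2
  have hu0 : Tendsto u atTop (𝓝 0) := (tendsto_nhdsWithin_iff.1 hu).1
  -- (1) the two one-sided bounds in the limit, for every margin `ν`
  have hbounds : ∀ ν : ℝ, 0 < ν → ν < 1 / 2 → ∀ (hx : (-1 - 2 * ν : ℝ) < 1 + 2 * ν)
      (hy : (-1 + 2 * ν : ℝ) < 1 - 2 * ν),
      1 ≤ g R + g (perturbQuad (swapC.trans Φ) (-1 - 2 * ν) (1 + 2 * ν) (-1 + 2 * ν) (1 - 2 * ν) hx hy) ∧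
        g R + g (perturbQuad (swapC.trans Φ) (-1 + 2 * ν) (1 - 2 * ν) (-1 - 2 * ν) (1 + 2 * ν) hy hx) ≤ 1 := by
    intro ν hν hν2 hx hy
    obtain ⟨δ₀, hδ₀, hmesh⟩ := selfDual_mesh_bounds R Φ hΦ ν hν hν2 hx hy
    have hsmall : ∀ᶠ n in atTop, u n ≤ δ₀ := (hu0.eventually (ge_mem_nhds hδ₀))
    set L := perturbQuad (swapC.trans Φ) (-1 - 2 * ν) (1 + 2 * ν) (-1 + 2 * ν) (1 - 2 * ν) hx hy with hL
    set U := perturbQuad (swapC.trans Φ) (-1 + 2 * ν) (1 - 2 * ν) (-1 - 2 * ν) (1 + 2 * ν) hy hx with hU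
    constructor
    · refine ge_of_tendsto ((hq R).add (hq L)) ?_
      filter_upwards [hupos, hsmall] with n hn1 hn2
      exact (hmesh (u n) hn1 hn2).1
    · refine le_of_tendsto ((hq R).add (hq U)) ?_
      filter_upwards [hupos, hsmall] with n hn1 hn2
      exact (hmesh (u n) hn1 hn2).2
  -- (2) the comparison quads have `g`-values close to `g R'`
  have happrox : ∀ ε : ℝ, 0 < ε → ∃ ν : ℝ, 0 < ν ∧ ν < 1 / 2 ∧ ∀ (hx : (-1 - 2 * ν : ℝ) < 1 + 2 * ν)
      (hy : (-1 + 2 * ν : ℝ) < 1 - 2 * ν),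
      |g (perturbQuad (swapC.trans Φ) (-1 - 2 * ν) (1 + 2 * ν) (-1 + 2 * ν) (1 - 2 * ν) hx hy) - g R'| ≤ ε ∧
        |g (perturbQuad (swapC.trans Φ) (-1 + 2 * ν) (1 - 2 * ν) (-1 - 2 * ν) (1 + 2 * ν) hy hx) - g R'| ≤ ε := by
    intro ε hε
    obtain ⟨η, hη, hT⟩ := abs_sub_map_le hu hg R' hε
    have hK : IsCompact (cthickening 1 (closure R'.carrier)) := by
      rw [hc]; exact R.isBounded.isCompact_closure.cthickening
    obtain ⟨τ₁, hτ₁, hdef⟩ := SelfDual.deform_close' Φ hK hη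
    set ν : ℝ := min (τ₁ / 2) (1 / 4) with hν
    have hν0 : 0 < ν := by positivity
    have hν2 : ν < 1 / 2 := (min_le_right _ _).trans_lt (by norm_num)
    have hντ : 2 * ν ≤ τ₁ := by linarith [min_le_left (τ₁ / 2) (1 / 4)]
    refine ⟨ν, hν0, hν2, fun hx hy => ?_⟩
    have hm : 0 < 1 - 2 * ν := by linarith
    have hp : 0 < 1 + 2 * ν := by linarith
    obtain ⟨A, hA⟩ := CountableApprox.exists_stretch (1 - 2 * ν) (1 + 2 * ν) hm.ne' hp.ne'
    obtain ⟨B, hB⟩ := CountableApprox.exists_stretch (1 + 2 * ν) (1 - 2 * ν) hp.ne' hm.ne'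
    have habs1 : |(1 - 2 * ν) - 1| ≤ τ₁ := by rw [abs_le]; constructor <;> linarith
    have habs2 : |(1 + 2 * ν) - 1| ≤ τ₁ := by rw [abs_le]; constructor <;> linarith
    have hTA := hT (Φ.symm.trans (A.trans Φ)) (hdef _ _ habs1 habs2 A hA)
    have hTB := hT (Φ.symm.trans (B.trans Φ)) (hdef _ _ habs2 habs1 B hB)
    constructor
    · -- `L_ν`: stretch factors `(1 - 2ν, 1 + 2ν)`
      have e := SelfDual.bondDomainCrossingProb_perturbQuad_eq_map hΦ hc h0 h2 hp hm (by ring) (by ring) hx hy A hA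
      have hgL : g (perturbQuad (swapC.trans Φ) (-1 - 2 * ν) (1 + 2 * ν) (-1 + 2 * ν) (1 - 2 * ν) hx hy) =
          g (R'.map (Φ.symm.trans (A.trans Φ))) := by
        refine tendsto_nhds_unique (hg _) ?_
        simp only [e]; exact hg _
      rw [hgL]; exact hTA
    · -- `U_ν`: stretch factors `(1 + 2ν, 1 - 2ν)`
      have e := SelfDual.bondDomainCrossingProb_perturbQuad_eq_map hΦ hc h0 h2 hm hp (by ring) (by ring) hy hx B hB
      have hgU : g (perturbQuad (swapC.trans Φ) (-1 + 2 * ν) (1 - 2 * ν) (-1 - 2 * ν) (1 + 2 * ν) hy hx) =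
          g (R'.map (Φ.symm.trans (B.trans Φ))) := by
        refine tendsto_nhds_unique (hg _) ?_
        simp only [e]; exact hg _
      rw [hgU]; exact hTB
  -- (3) conclude: `1 - ε ≤ g R + g R' ≤ 1 + ε` for every `ε > 0`
  refine le_antisymm ?_ ?_
  · refine le_of_forall_pos_le_add fun ε hε => ?_
    obtain ⟨ν, hν, hν2, hnear⟩ := happrox ε hε
    have hx : (-1 - 2 * ν : ℝ) < 1 + 2 * ν := by linarith
    have hy : (-1 + 2 * ν : ℝ) < 1 - 2 * ν := by linarith
    have h1 := (hbounds ν hν hν2 hx hy).2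
    have h2 := (hnear hx hy).2
    rw [abs_le] at h2
    linarith [h2.1]
  · refine le_of_forall_pos_le_add fun ε hε => ?_
    obtain ⟨ν, hν, hν2, hnear⟩ := happrox ε hε
    have hx : (-1 - 2 * ν : ℝ) < 1 + 2 * ν := by linarith
    have hy : (-1 + 2 * ν : ℝ) < 1 - 2 * ν := by linarith
    have h1 := (hbounds ν hν hν2 hx hy).1
    have h2 := (hnear hx hy).1
    rw [abs_le] at h2
    linarith [h2.2]

end JointLimit

/-- **Registered sub-goal `jointLimit_selfDual` (line `registered`, lead c4; structure of joint limits,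
part 8) — every joint sequential limit of the bond-`ℤ²` crossing probabilities is SELF-DUAL on every
conformal rectangle**: if `u n → 0⁺` and `bondDomainCrossingProb R (u n) → g R` for every conformal
rectangle `R`, then `g R + g R⁺ = 1` whenever `R⁺` is the cyclic re-marking of `R` (same carrier,
`R⁺.arc 0 = R.arc 1`, `R⁺.arc 2 = R.arc 3`; such `R⁺` exists, `MarkedDomain.exists_shiftMarks`).
Generalises part 7 (`jointLimit_rectSelfDual`, boxes). [cite: SchrammSmirnov2011, §1.3] -/
theorem jointLimit_selfDual : ∀ u : ℕ → ℝ, Filter.Tendsto u Filter.atTop (nhdsWithin (0 : ℝ) (Set.Ioi 0)) → ∀ g : Literature.Probability.RandomPlanarGeometry.ConformalRectangle → ℝ, (∀ R : Literature.Probability.RandomPlanarGeometry.ConformalRectangle, Filter.Tendsto (fun n => Literature.Probability.Percolation.bondDomainCrossingProb R (u n)) Filter.atTop (nhds (g R))) → ∀ (R R' : Literature.Probability.RandomPlanarGeometry.ConformalRectangle), R'.carrier = R.carrier → R'.arc 0 = R.arc 1 → R'.arc 2 = R.arc 3 → g R + g R' = 1 :=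
  fun _ hu _ hg R R' hc h0 h2 => JointLimit.add_shift_eq_one hu hg R R' hc h0 h2

end Summit.CriticalPhenomena.CardyFormulaZ2.Cruxes.SubseqCardy.Birth

end
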